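import Summits.QuantumFields.YangMills.Theorems.BalabanUVNodesN11NoExpansionTermFree

/-!
# DAG node N11 — the term-free first instance of (S1ᵀ)₁₃ AT AN ARBITRARY STAGE-13 WITNESS (any residual 𝐓-weights `θ.Zt`): the no-expansion integrand is
# `ζ0_0(T)·χreg_0(T)·e^{−½quad_0(∅)}·e^{E−E_1}·ρ₀`, SUPPORTED ON THE `cR·ε₀`-REGULAR FINE FIELDS whatever `Zt` is, and `TLaw₁₃ θ p 0` demands the
# corresponding weights-only transport equation — a test of def-T's step weights against the averaging of record that no `Zt` re-pin and no term choice evades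

Cell `pub-ymgap`, YM-PLAN Track A (HUMAN RULING D-0062), seat `pub-ymgap-dag-n11-d` (g4; R134 fan-out seat N11 [B14], strategy s2), item K1‴ `StabilityBAtRecordR13e`
= stmt-QuantumFields-19910.  [III] = [Balaban1988Convergent].  Sequel of `BalabanUVNodesN11NoExpansionTermFree` (same seat: §1 the (2.23) action along the
all-large-field history is `−g₀⁻²A(U) − E` for every term witness; §§3–4 the closed form and the weights-only necessary condition at `θ.Zt = ZtOfRecord`), split
off for the Theorems lane's 400-line bound.

WHY THIS FILE.  File 1's necessary condition was stated at the witnesses carrying K0b's `ZtOfRecord`, where the door it points to is a `Zt` re-pin.  HERE the same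
computation is carried out at an ARBITRARY `θ.Zt`: the term-free integrand keeps the factors `ζ0_0(T)(U,V₁)` and `e^{−½quad_0(∅)(U,V₁)}` of the witness's residual
weights (`noExpIntegrand_termFree`), and — the point — 12a's pin `ζ_0 = ζ0·χreg_0(T)` makes it VANISH AT EVERY `cR·ε₀`-IRREGULAR fine field `U` for every `Zt`,
every `V₁`, every operand (`noExpIntegrand_eq_zero_of_not_plaqSmallOn`).  So `TLaw₁₃ θ p 0` demands (`tLaw₁₃_zero_termFree`; junction, `M ≥ 1`, `0 < K`;
measurability ∕ bound of the `Zt`-part displayed — `Provisos₁₃` has no measurability row for `Zt`): `slotT_1(s′) ≡ 0` or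
`T[w(s′)(·,V₁)ρ₀] =ᵐ T[ζ0_0(T)·χreg_0(T)·e^{−½quad_0(∅)}·e^{E−E_1}ρ₀]`, whose right side is the transport of an integrand supported on the regular fine fields —
hence ON EVERY SET OF `V₁` WHOSE AVERAGING FIBRES MISS THE REGULAR FINE FIELDS THE ALL-LARGE-FIELD PRE-𝐑 SLOT `T[w(s′)ρ₀]` MUST VANISH a.e., at EVERY witness of the
rev-16 items built over def-T's `wOfRecord` and 12a's `tkWeightsOfRecord`.  Whether def-T's step weights pass this test is NOT decided here (the (3.2)∕(3.3)
indicators inside `w` are evaluated on def-R's classical backgrounds `ukBox ∘ bgOfRecord` — junk unit branch off the (2.12) class, `StepWeightsOfRecord.chiFactor` —,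
and no fibre-positivity fact for the block averaging is in the tree); it is the located question the K0‴∕K1‴ designers and 11a∕12a's pens must answer BEFORE any
`Zt` re-pin can help: if rough `V₁` carry mass of `w(s′)` for the all-large-field `s′`, the typed (S1ᵀ) fails at `k = 0` for every witness — a statement defect
(12a's regularity cut ranging over `Y = T` at the all-large-field sequence), not a fact about Bałaban, whose 𝐓 carries one weight family.

WHAT THIS FILE PROVES (0 `sorry`, 0 `def`, standard axioms; `N`-generic): **`noExpIntegrand_termFree`**, **`noExpIntegrand_eq_zero_of_not_plaqSmallOn`**,
**`tLaw₁₃_zero_termFree`**.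

HONEST FRAMING.  Count-neutral kernel bookkeeping on the tree's OWN objects; a necessary-condition READING, not a proof that (S1ᵀ)₁₃ holds or fails anywhere;
nothing of Bałaban's asserted or refuted; N11 ∕ K1‴ NOT discharged ∕ refuted; counts unmoved (typed 28∕28 · discharged 5∕28).  One finite four-torus programme at
fixed `ε = L^{−K}`; NOT ℝ⁴, NOT OS, NOT a mass gap, NOT Clay.  Sources: [III] (2.10) p. 256, (2.18) p. 257, (2.21)–(2.23) p. 258, (3.1)–(3.2) pp. 264–265,
(3.25) p. 270, Theorem p. 245, Thm 1 p. 262.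
-/

noncomputable section

open MeasureTheory
open scoped BigOperators Matrix.Norms.L2Operator

namespace Summit.QuantumFields.YangMills.Theorems.BalabanUVNodesN11NoExpansionTermFreeAnyWeights

open Literature.MathematicalPhysics.QuantumFieldTheory.Balaban1983to89 T4Continuum Node00 Node00.Tk DagBinding
open Summit.QuantumFields.YangMills.Theorems.BalabanUVNodesN11NoExpansionTermFree (exp_action23_one_eq_rhoZero_of_Omega_empty₁₃)

variable {F : T4Family} {N : ℕ} [NeZero N]

/-! ## AT EVERY STAGE-13 `θ` (ANY residual 𝐓-weights): the term-free integrand, its SUPPORT ON THE REGULAR FINE FIELDS, and the necessary condition -/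

section AnyWeights

variable (θ : Stage13Params F N) (p : B12.RunParams)

/-- **THE TERM-FREE NO-EXPANSION INTEGRAND AT AN ARBITRARY STAGE-13 `θ`** (any residual 𝐓-weight datum `θ.Zt`; junction, `M ≥ 1`; both branches of p. 256's
regularity factor): at the all-large-field new sequence, for EVERY term-value witness `(t, E_1)`,
`noExpIntegrand (WtOfRecord₁₃ θ p) (exp A_1(s′) at UbgOfRecord₁₃ θ p 1 s′) V₁ U = ζ0_0(T)(U,V₁) · χreg_0(T)(U,V₁) · e^{−½quad_0(∅)(U,V₁)} · (e^{E − E_1}·ρ₀(U))`.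
[cite: Balaban1988Convergent, (2.10) p.256, (2.18) p.257, (2.21)–(2.23) p.258, Thm 1 p.262] -/
theorem noExpIntegrand_termFree (hc : θ.s2.cR * epsOfRecord θ.ν (gOfRecord₁₃ F N θ p) 0 ≤ θ.ν.εreg * (F.P p.K).eta 0 ^ 2) (hM : 1 ≤ θ.τ9.M)
    (s : SeqOfRecord F θ.ν θ.τ9.M (gOfRecord₁₃ F N θ p) p.K 1) (hΩ : s.Ω 1 = ∅)
    (t : Sect2.TermValues (F.P p.K) (MatA N) (FluctV N) θ.τ9.M) (Ek : ℝ) (V1 : GaugeField (F.P p.K) 1 (SU N)) (Uf : GaugeField (F.P p.K) 0 (SU N)) :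
    noExpIntegrand F N (FluctV N) p.K (WtOfRecord₁₃ F N θ p)
        (sect2Operand F N (FluctV N) p.K (settingOfRecord₁₃ F N θ p) (θ.Rz p.K) s t Ek (UbgOfRecord₁₃ F N θ p 1 s)) V1 Uf =
      (θ.Zt p.K).ζ0 0 Set.univ (pairCfg V1 Uf) *
          chiRegW F N (FluctV N) θ.ν θ.s2.cR p (gOfRecord₁₃ F N θ p) 0 Set.univ (pairCfg (V := FluctV N) V1 Uf) *
        (Real.exp (-(1 / 2 : ℝ) * (θ.Zt p.K).quad 0 ∅ (pairCfg V1 Uf)) *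
          (Real.exp (EOfRecord₁₃ F N θ p - Ek) * rhoZeroOfRecord F N p.K p.g0 (EOfRecord₁₃ F N θ p) Uf)) := by
  by_cases h : chiRegW F N (FluctV N) θ.ν θ.s2.cR p (gOfRecord₁₃ F N θ p) 0 Set.univ (pairCfg (V := FluctV N) V1 Uf) ≠ 0
  · rw [noExpIntegrand_WtOfRecord₁₃_sect2Operand_of_chiRegW_ne_zero θ p hc s hΩ t Ek V1 Uf h,
      exp_action23_one_eq_rhoZero_of_Omega_empty₁₃ θ p hM s hΩ t _ Ek Uf]
  · rw [not_not] at h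
    rw [noExpIntegrand_WtOfRecord₁₃_eq_zero_of_chiRegW_eq_zero θ p _ V1 Uf h, h, mul_zero, zero_mul]

/-- **THE NO-EXPANSION INTEGRAND IS SUPPORTED ON THE `cR·ε₀`-REGULAR FINE FIELDS — AT EVERY `θ`, FOR EVERY OPERAND** (12a's pin `ζ_0 = ζ0·χreg_0(T)`): at an
irregular `U` it vanishes whatever `V₁`, the residual weights and the term values are. [cite: Balaban1988Convergent, (2.10) p.256, (2.21) p.258] -/
theorem noExpIntegrand_eq_zero_of_not_plaqSmallOn (Φ : SFluct (F.P p.K) (FluctV N) → B15DeterminingSets.MSField (F.P p.K) (SU N) → ℝ)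
    (V1 : GaugeField (F.P p.K) 1 (SU N)) (Uf : GaugeField (F.P p.K) 0 (SU N))
    (hU : ¬ PlaqSmallOn (B8Eq17ClassAkV1.plaqsOf (B15DeterminingSets.pts 0 (Set.univ : Set (Site (F.P p.K) 0))))
      (θ.s2.cR * epsOfRecord θ.ν (gOfRecord₁₃ F N θ p) 0) Uf) :
    noExpIntegrand F N (FluctV N) p.K (WtOfRecord₁₃ F N θ p) Φ V1 Uf = 0 := by
  refine noExpIntegrand_WtOfRecord₁₃_eq_zero_of_chiRegW_eq_zero θ p Φ V1 Uf ?_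
  rw [chiRegW_zero_pairCfg, if_neg hU]

/-- **WHAT `TLaw₁₃ θ p 0` DEMANDS AT THE ALL-LARGE-FIELD SEQUENCE OF AN ARBITRARY STAGE-13 `θ`** (junction, `M ≥ 1`, `0 < K`; the joint measurability and a bound
of `(V₁, U) ↦ ζ0_0(T)(U,V₁)·χreg_0(T)(U,V₁)·e^{−½quad_0(∅)(U,V₁)}·ρ₀(U)` DISPLAYED — `Provisos₁₃` carries no measurability row for `Zt`): for the witness's constant `E_1`,
EITHER `slotT_1(s′) ≡ 0` OR, `dV₁`-a.e., `T[w(s′)(·,V₁)·ρ₀](V₁) = e^{E−E_1}·T[ζ0_0(T)(·,V₁)·χreg_0(T)(·,V₁)·e^{−½quad_0(∅)(·,V₁)}·ρ₀](V₁)` — a condition on the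
witness's TWO weight families (def-T's `w` through `θ.ζ`, 12a's through `θ.Zt`) and the Wilson start ALONE; the right-hand integrand is supported on the
`cR·ε₀`-regular fine fields (`noExpIntegrand_eq_zero_of_not_plaqSmallOn`) WHATEVER `θ.Zt` is.  Hence, for ANY witness: on every set of `V₁` whose averaging
fibres miss the regular fine fields, the all-large-field pre-𝐑 slot `T[w(s′)ρ₀]` must vanish a.e. — a test of def-T's step weights against the averaging of
record that no `Zt` re-pin and no term choice can evade. [cite: Balaban1988Convergent, Theorem p.245, (3.1)–(3.2) pp.264–265, (3.25) p.270, (2.10) p.256, (2.21)–(2.23) p.258] -/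
theorem tLaw₁₃_zero_termFree (hc : θ.s2.cR * epsOfRecord θ.ν (gOfRecord₁₃ F N θ p) 0 ≤ θ.ν.εreg * (F.P p.K).eta 0 ^ 2) (hM : 1 ≤ θ.τ9.M)
    (hK : 0 < p.K) (s : SeqOfRecord F θ.ν θ.τ9.M (gOfRecord₁₃ F N θ p) p.K 1) (hΩ : s.Ω 1 = ∅) (hT : TLaw₁₃ F N θ p 0)
    {C : ℝ}
    (hm : Measurable (Function.uncurry fun (V1 : GaugeField (F.P p.K) 1 (SU N)) (Uf : GaugeField (F.P p.K) 0 (SU N)) =>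
      (θ.Zt p.K).ζ0 0 Set.univ (pairCfg V1 Uf) *
          chiRegW F N (FluctV N) θ.ν θ.s2.cR p (gOfRecord₁₃ F N θ p) 0 Set.univ (pairCfg (V := FluctV N) V1 Uf) *
        (Real.exp (-(1 / 2 : ℝ) * (θ.Zt p.K).quad 0 ∅ (pairCfg V1 Uf)) * rhoZeroOfRecord F N p.K p.g0 (EOfRecord₁₃ F N θ p) Uf)))
    (hC : ∀ (V1 : GaugeField (F.P p.K) 1 (SU N)) (Uf : GaugeField (F.P p.K) 0 (SU N)),
      |(θ.Zt p.K).ζ0 0 Set.univ (pairCfg V1 Uf) *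
          chiRegW F N (FluctV N) θ.ν θ.s2.cR p (gOfRecord₁₃ F N θ p) 0 Set.univ (pairCfg (V := FluctV N) V1 Uf) *
        (Real.exp (-(1 / 2 : ℝ) * (θ.Zt p.K).quad 0 ∅ (pairCfg V1 Uf)) * rhoZeroOfRecord F N p.K p.g0 (EOfRecord₁₃ F N θ p) Uf)| ≤ C) :
    ∃ Ek : ℝ,
      slotsTOfRecord F N θ.ν θ.τ9 (EOfRecord₁₃ F N θ) (wOfRecord₉ F N θ.toStage9Params) θ.ppSel p
          (gOfRecord₁₃ F N θ p) 1 s = 0 ∨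
        (fun V1 => transportOfRecord F N p.K 0 (fun U => wOfRecord₉ F N θ.toStage9Params p (gOfRecord₁₃ F N θ p) 0 s U V1 *
            rhoZeroOfRecord F N p.K (gOfRecord₁₃ F N θ p 0) (EOfRecord₁₃ F N θ p) U) V1)
          =ᵐ[fieldMeasure (F.P p.K) 1 (SU N)]
        fun V1 => transportOfRecord F N p.K 0 (fun Uf =>
            (θ.Zt p.K).ζ0 0 Set.univ (pairCfg V1 Uf) *
                chiRegW F N (FluctV N) θ.ν θ.s2.cR p (gOfRecord₁₃ F N θ p) 0 Set.univ (pairCfg (V := FluctV N) V1 Uf) *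
              (Real.exp (-(1 / 2 : ℝ) * (θ.Zt p.K).quad 0 ∅ (pairCfg V1 Uf)) *
                (Real.exp (EOfRecord₁₃ F N θ p - Ek) * rhoZeroOfRecord F N p.K p.g0 (EOfRecord₁₃ F N θ p) Uf))) V1 := by
  obtain ⟨t, Ekf, -, -, hcl⟩ := tLaw₁₃_zero_clause_of_Omega_empty θ p hT s hΩ
  refine ⟨Ekf s, ?_⟩
  set c : ℝ := Real.exp (EOfRecord₁₃ F N θ p - Ekf s) with hc_def
  -- the integrand of `…AtRecord13`'s coherence equation IS the term-free one (pointwise)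
  have hI : noExpIntegrand F N (FluctV N) p.K (WtOfRecord₁₃ F N θ p)
      (sect2Operand F N (FluctV N) p.K (settingOfRecord₁₃ F N θ p) (θ.Rz p.K) s (t s) (Ekf s) (UbgOfRecord₁₃ F N θ p 1 s)) =
      fun (V1 : GaugeField (F.P p.K) 1 (SU N)) (Uf : GaugeField (F.P p.K) 0 (SU N)) =>
        (θ.Zt p.K).ζ0 0 Set.univ (pairCfg V1 Uf) *
            chiRegW F N (FluctV N) θ.ν θ.s2.cR p (gOfRecord₁₃ F N θ p) 0 Set.univ (pairCfg (V := FluctV N) V1 Uf) *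
          (Real.exp (-(1 / 2 : ℝ) * (θ.Zt p.K).quad 0 ∅ (pairCfg V1 Uf)) *
            (c * rhoZeroOfRecord F N p.K p.g0 (EOfRecord₁₃ F N θ p) Uf)) := by
    funext V1 Uf
    rw [noExpIntegrand_termFree θ p hc hM s hΩ (t s) (Ekf s) V1 Uf]
  have hfun : (Function.uncurry fun (V1 : GaugeField (F.P p.K) 1 (SU N)) (Uf : GaugeField (F.P p.K) 0 (SU N)) =>
        (θ.Zt p.K).ζ0 0 Set.univ (pairCfg V1 Uf) *
            chiRegW F N (FluctV N) θ.ν θ.s2.cR p (gOfRecord₁₃ F N θ p) 0 Set.univ (pairCfg (V := FluctV N) V1 Uf) *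
          (Real.exp (-(1 / 2 : ℝ) * (θ.Zt p.K).quad 0 ∅ (pairCfg V1 Uf)) *
            (c * rhoZeroOfRecord F N p.K p.g0 (EOfRecord₁₃ F N θ p) Uf))) =
      fun z => c * (Function.uncurry (fun (V1 : GaugeField (F.P p.K) 1 (SU N)) (Uf : GaugeField (F.P p.K) 0 (SU N)) =>
        (θ.Zt p.K).ζ0 0 Set.univ (pairCfg V1 Uf) *
            chiRegW F N (FluctV N) θ.ν θ.s2.cR p (gOfRecord₁₃ F N θ p) 0 Set.univ (pairCfg (V := FluctV N) V1 Uf) *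
          (Real.exp (-(1 / 2 : ℝ) * (θ.Zt p.K).quad 0 ∅ (pairCfg V1 Uf)) * rhoZeroOfRecord F N p.K p.g0 (EOfRecord₁₃ F N θ p) Uf)) z) := by
    funext z
    rcases z with ⟨V1, Uf⟩
    simp only [Function.uncurry_apply_pair]
    ring
  have hm' : Measurable (Function.uncurry (noExpIntegrand F N (FluctV N) p.K (WtOfRecord₁₃ F N θ p)
      (sect2Operand F N (FluctV N) p.K (settingOfRecord₁₃ F N θ p) (θ.Rz p.K) s (t s) (Ekf s) (UbgOfRecord₁₃ F N θ p 1 s)))) := by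
    rw [hI, hfun]
    exact hm.const_mul c
  have hC' : ∀ (V1 : GaugeField (F.P p.K) 1 (SU N)) (Uf : GaugeField (F.P p.K) 0 (SU N)),
      |noExpIntegrand F N (FluctV N) p.K (WtOfRecord₁₃ F N θ p)
        (sect2Operand F N (FluctV N) p.K (settingOfRecord₁₃ F N θ p) (θ.Rz p.K) s (t s) (Ekf s) (UbgOfRecord₁₃ F N θ p 1 s)) V1 Uf| ≤ |c| * C := by
    intro V1 Uf
    have h2 : noExpIntegrand F N (FluctV N) p.K (WtOfRecord₁₃ F N θ p)
        (sect2Operand F N (FluctV N) p.K (settingOfRecord₁₃ F N θ p) (θ.Rz p.K) s (t s) (Ekf s) (UbgOfRecord₁₃ F N θ p 1 s)) V1 Uf =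
        c * ((θ.Zt p.K).ζ0 0 Set.univ (pairCfg V1 Uf) *
            chiRegW F N (FluctV N) θ.ν θ.s2.cR p (gOfRecord₁₃ F N θ p) 0 Set.univ (pairCfg (V := FluctV N) V1 Uf) *
          (Real.exp (-(1 / 2 : ℝ) * (θ.Zt p.K).quad 0 ∅ (pairCfg V1 Uf)) * rhoZeroOfRecord F N p.K p.g0 (EOfRecord₁₃ F N θ p) Uf)) := by
      rw [noExpIntegrand_termFree θ p hc hM s hΩ (t s) (Ekf s) V1 Uf]
      ring
    rw [h2, abs_mul]
    exact mul_le_mul_of_nonneg_left (hC V1 Uf) (abs_nonneg _)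
  have h := tLaw₁₃_zero_coherence_of_Omega_empty θ p hK s hΩ (t s) (Ekf s) hcl hm' hC'
  rw [hI] at h
  exact h

end AnyWeights

end Summit.QuantumFields.YangMills.Theorems.BalabanUVNodesN11NoExpansionTermFreeAnyWeights

end
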